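import Summits.Parity.BatemanHorn.Theorems.SoloInformedBatemanHornLocalisation
import Literature.NumberTheory.Sieve.AletheiaZomleferFukshanskyGarcia2020Applications
import Literature.NumberTheory.Sieve.SingularSeriesProofs

/-!
# SoloInformedTwinPrimeLocalisation — the twin prime instance of the localisation theorem

Solo unit `solo-Parity-informed` (ideation tier, informed mode), session 17; `PLAN.md` §25.7,
CLAIMS C89.

The most classical instance of `SoloInformedBatemanHornLocalisation`, spelled out with no
Bateman–Horn vocabulary left: for every fixed `0 < ε < 1`, the Hardy–Littlewood twin prime
asymptotic `π₂(x) ~ 2 C₂ x / log² x` holds **if and only if**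
`∑_{n ≤ x} ∑_{e ∣ n(n+2), e > x^{1-ε}} μ(e) log² e = o(x)`.

* `batemanHornAsymptotic_twinSystem_iff` — the tree's `BatemanHornAsymptotic ![X, X + 2]` is the
  Hardy–Littlewood twin prime asymptotic (the Bateman–Horn constant of the twin system is `2 C₂`,
  tree facts `hasBatemanHornConst_twinSystem`, `tendsto_twinPrimeConstPartial_holds`);
* `twinPrime_isEquivalent_iff_tail_isLittleO` — the localisation for twin primes.
-/

namespace Summit.Parity.BatemanHorn.Theorems

open Finset Filter Asymptotics Polynomial ArithmeticFunction
open scoped ArithmeticFunction.Moebius Topology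
open Literature.NumberTheory.Sieve

/-- The Bateman–Horn asymptotic for the twin system `![X, X + 2]` is the Hardy–Littlewood twin
prime asymptotic `π₂(x) ~ 2 C₂ x / log² x`. -/
theorem batemanHornAsymptotic_twinSystem_iff :
    BatemanHornAsymptotic twinSystem ↔
      (fun x : ℕ => (twinPrimeCount x : ℝ)) ~[atTop]
        fun x : ℕ => 2 * twinPrimeConst * x / Real.log x ^ 2 := by
  have hC := hasBatemanHornConst_twinSystem tendsto_twinPrimeConstPartial_holds
  have hdeg : ((X : ℤ[X]) + 2).natDegree = 1 := by simpa using natDegree_X_add_C (2 : ℤ)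
  constructor
  · rintro ⟨C, hC', hQ⟩
    have hCeq : C = 2 * twinPrimeConst := tendsto_nhds_unique hC' hC
    convert hQ using 2 with x x
    · rw [polyPrimeCount_twinSystem]
    · simp [twinSystem, hCeq, hdeg]
  · intro h
    refine ⟨2 * twinPrimeConst, hC, ?_⟩
    convert h using 2 with x x
    · rw [polyPrimeCount_twinSystem]
    · simp [twinSystem, hdeg]

/-- **The twin prime conjecture, localised.**  For every fixed `0 < ε < 1`:
`π₂(x) ~ 2 C₂ x / log² x ⟺ ∑_{n ≤ x} ∑_{e ∣ n(n+2), e > x^{1-ε}} μ(e) log² e = o(x)`. -/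
theorem twinPrime_isEquivalent_iff_tail_isLittleO {ε : ℝ} (hε : 0 < ε) (hε1 : ε < 1) :
    (fun x : ℕ => (twinPrimeCount x : ℝ)) ~[atTop]
        (fun x : ℕ => 2 * twinPrimeConst * x / Real.log x ^ 2) ↔
      (fun x : ℕ => ∑ n ∈ Icc 1 x,
          ∑ e ∈ (n * (n + 2)).divisors with ⌊(x : ℝ) ^ (1 - ε)⌋₊ < e,
            (μ e : ℝ) * Real.log e ^ 2) =o[atTop] fun x : ℕ => (x : ℝ) := by
  rw [← batemanHornAsymptotic_twinSystem_iff,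
    batemanHornAsymptotic_iff_rpowCut_tail_isLittleO isBatemanHornSystem_twinSystem hε hε1]
  have hF : ∀ n : ℕ, (((∏ i, twinSystem i).eval (n : ℤ)).natAbs) = n * (n + 2) := by
    intro n
    have h : (∏ i, twinSystem i).eval (n : ℤ) = ((n * (n + 2) : ℕ) : ℤ) := by
      simp only [twinSystem, Fin.prod_univ_two, Matrix.cons_val_zero, Matrix.cons_val_one,
        eval_mul, eval_X, eval_add, eval_ofNat]
      push_cast
      ring
    rw [h, Int.natAbs_natCast]
  simp_rw [hF, Fintype.card_fin]

end Summit.Parity.BatemanHorn.Theorems
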